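import Summits.ResolutionOfSingularities.ResolutionOfSingularities.Theorems.EquisingularLiftEquisingularLiftNatSpecimenWhitneyCubicForms
import Literature.AlgebraicGeometry.Resolution.BlowupAlgebraFlatBaseChange
import Mathlib.RingTheory.TensorProduct.MvPolynomial
import Mathlib.RingTheory.RegularLocalRing.Polynomial
import Mathlib.RingTheory.Polynomial.Quotient
import Mathlib.RingTheory.Polynomial.Basic
import HarnessLib

/-!
# [OURS · L1 W4.5(b)] IDLE VARIABLES: renaming along an injection, primality, quotients and regularity; affine blow-up algebras under
# polynomial base change (crux `Theses.EquisingularLift.EquisingularLiftNat`, stmt-ResolutionOfSingularities-20038 — algebra for the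
# cones with a linear vertex `ℙʳ`)

NOT a statement of any manuscript; OURS generic commutative algebra (cell `res-hironaka`, chain w45b; seat res-D-pv-013, own initiative, counted 0).
AI-written, weaker than expert review. No definition, no `sorry`, standard axioms.

For an injective map of index types `τ : σ → σ'` ("adjoining the idle variables `x ∉ range τ`"):

* `IdleVar.exists_algEquiv_rename_eq_C` — `R[σ'] ≃ₐ[R] (R[σ])[τᶜ]` taking `rename τ p` to the constant `C p` and an idle variable to itself
  (Mathlib `sumAlgEquiv`, as in Mathlib's `MvPolynomial.prime_rename_iff` for subtype inclusions);
* `IdleVar.prime_rename` — `p` prime ⇒ `rename τ p` prime (`MvPolynomial.prime_C_iff`);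
* `IdleVar.exists_quotient_rename_equiv` — `R[σ']/(rename τ p) ≃+* (R[σ]/(p))[τᶜ]` with `[rename τ q] ↦ C [q]`
  (`MvPolynomial.quotientEquivQuotientMvPolynomial`);
* `IdleVar.isRegularRing_quotient_rename` — `R[σ]/(p)` regular ⇒ `R[σ']/(rename τ p)` regular (`τᶜ` finite; Mathlib
  `MvPolynomial.isRegularRing_of_isRegularRing`);
* **`IdleVar.isRegularRing_blowupAlgebra_mvPolynomial`** — `A[I/a]` regular ⇒ `A[y][I·A[y]/a]` regular: affine blow-up algebras commute with the
  flat base change `A → A[y]` (tree `BlowupAlgebraFlatBaseChange`, Stacks 0805: the square is a pushout, `Algebra.IsPushout.equiv`) and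
  `A[y] ⊗_A A[I/a] ≅ (A[I/a])[y]` (Mathlib `MvPolynomial.scalarRTensorAlgEquiv`).

References: The Stacks Project 0805; Görtz–Wedhorn I Prop. 13.91 — through the cited tree file.
-/

set_option linter.dupNamespace false -- mandated namespace `Summit.<Summit>.<Problem>` of this single-conjunct summit

noncomputable section

open MvPolynomial TensorProduct
open Literature.AlgebraicGeometry.Resolution

namespace Summit.ResolutionOfSingularities.ResolutionOfSingularities.Cruxes.EquisingularLiftNat.Sections

namespace IdleVar

universe u

/-! ## Renaming along an injection = adjoining idle variables -/

/-- **`R[σ'] ≅ (R[σ])[τᶜ]` for an injective `τ : σ → σ'`**, with `rename τ p ↦ C p` and `X x ↦ X ⟨x, _⟩` for `x ∉ range τ`. [folklore] -/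
theorem exists_algEquiv_rename_eq_C {R : Type u} [CommRing R] {σ σ' : Type u} (τ : σ → σ') (hτ : Function.Injective τ) :
    ∃ ψ : MvPolynomial σ' R ≃ₐ[R] MvPolynomial ((Set.range τ)ᶜ : Set σ') (MvPolynomial σ R),
      (∀ p, ψ (rename τ p) = C p) ∧ ∀ (x : σ') (hx : x ∉ Set.range τ), ψ (X x) = X ⟨x, hx⟩ := by
  classical
  let s : Set σ' := Set.range τ
  let Θ : σ' ≃ (sᶜ : Set σ') ⊕ σ :=
    ((Equiv.Set.sumCompl s).symm.trans (Equiv.sumComm _ _)).trans (Equiv.sumCongr (Equiv.refl _) (Equiv.ofInjective τ hτ).symm)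
  have hΘτ : ∀ i, Θ (τ i) = Sum.inr i := by
    intro i
    have h1 : (Equiv.Set.sumCompl s).symm (τ i) = Sum.inl ⟨τ i, Set.mem_range_self i⟩ :=
      Equiv.Set.sumCompl_symm_apply_of_mem (Set.mem_range_self i)
    simp only [Θ, Equiv.trans_apply, h1, Equiv.sumComm_apply, Sum.swap_inl, Equiv.sumCongr_apply, Sum.map_inr]
    congr 1
    exact Equiv.ofInjective_symm_apply hτ i
  have hΘx : ∀ (x : σ') (hx : x ∉ s), Θ x = Sum.inl ⟨x, hx⟩ := by
    intro x hx
    have h1 : (Equiv.Set.sumCompl s).symm x = Sum.inr ⟨x, hx⟩ := Equiv.Set.sumCompl_symm_apply_of_notMem hx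
    simp only [Θ, Equiv.trans_apply, h1, Equiv.sumComm_apply, Sum.swap_inr, Equiv.sumCongr_apply, Sum.map_inl, Equiv.refl_apply]
  let ψ : MvPolynomial σ' R ≃ₐ[R] MvPolynomial (sᶜ : Set σ') (MvPolynomial σ R) :=
    (renameEquiv R Θ).trans (sumAlgEquiv R _ σ)
  refine ⟨ψ, fun p => ?_, fun x hx => ?_⟩
  · have h := MvPolynomial.algHom_ext (A := MvPolynomial (sᶜ : Set σ') (MvPolynomial σ R))
      (f := (ψ : MvPolynomial σ' R →ₐ[R] _).comp (rename τ))
      (g := (Algebra.ofId (MvPolynomial σ R) (MvPolynomial (sᶜ : Set σ') (MvPolynomial σ R))).restrictScalars R) fun i => by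
        rw [AlgHom.comp_apply, rename_X, AlgHom.restrictScalars_apply, Algebra.ofId_apply, MvPolynomial.algebraMap_eq]
        change (sumAlgEquiv R _ σ) (renameEquiv R Θ (X (τ i))) = C (X i)
        rw [renameEquiv_apply, rename_X, hΘτ, sumAlgEquiv_X_inr]
    have h' := DFunLike.congr_fun h p
    rw [AlgHom.comp_apply, AlgHom.restrictScalars_apply, Algebra.ofId_apply, MvPolynomial.algebraMap_eq] at h'
    exact h'
  · change (sumAlgEquiv R _ σ) (renameEquiv R Θ (X x)) = X ⟨x, hx⟩
    rw [renameEquiv_apply, rename_X, hΘx x hx, sumAlgEquiv_X_inl]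

/-- **Renaming along an injection preserves primality.** [folklore] -/
theorem prime_rename {R : Type u} [CommRing R] {σ σ' : Type u} (τ : σ → σ') (hτ : Function.Injective τ) {p : MvPolynomial σ R}
    (hp : Prime p) : Prime (rename τ p) := by
  obtain ⟨ψ, hψ, -⟩ := exists_algEquiv_rename_eq_C (R := R) τ hτ
  rw [← MulEquiv.prime_iff ψ.toMulEquiv]
  change Prime (ψ (rename τ p))
  rw [hψ]
  exact (MvPolynomial.prime_C_iff _).mpr hp

/-- **`R[σ']/(rename τ p) ≅ (R[σ]/(p))[τᶜ]`** with `[rename τ q] ↦ C [q]`. [folklore] -/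
theorem exists_quotient_rename_equiv {R : Type u} [CommRing R] {σ σ' : Type u} (τ : σ → σ') (hτ : Function.Injective τ)
    (p : MvPolynomial σ R) :
    ∃ θ : (MvPolynomial σ' R ⧸ Ideal.span {rename τ p}) ≃+*
        MvPolynomial ((Set.range τ)ᶜ : Set σ') (MvPolynomial σ R ⧸ Ideal.span {p}),
      ∀ q, θ (Ideal.Quotient.mk _ (rename τ q)) = C (Ideal.Quotient.mk _ q) := by
  obtain ⟨ψ, hψ, -⟩ := exists_algEquiv_rename_eq_C (R := R) τ hτ
  have hmap : Ideal.map (C : MvPolynomial σ R →+* MvPolynomial ((Set.range τ)ᶜ : Set σ') (MvPolynomial σ R)) (Ideal.span {p}) =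
      Ideal.map (ψ.toRingEquiv : MvPolynomial σ' R →+* _) (Ideal.span {rename τ p}) := by
    rw [Ideal.map_span, Set.image_singleton, Ideal.map_span, Set.image_singleton]
    refine congrArg (fun q => Ideal.span {q}) ?_
    change C p = ψ (rename τ p)
    exact (hψ p).symm
  let θ₁ := Ideal.quotientEquiv (Ideal.span {rename τ p}) _ ψ.toRingEquiv hmap
  let θ₂ := (MvPolynomial.quotientEquivQuotientMvPolynomial (σ := ((Set.range τ)ᶜ : Set σ')) (Ideal.span {p})).toRingEquiv.symm
  refine ⟨θ₁.trans θ₂, fun q => ?_⟩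
  · have h1 : θ₁ (Ideal.Quotient.mk _ (rename τ q)) = Ideal.Quotient.mk _ (C q) := by
      rw [show θ₁ (Ideal.Quotient.mk _ (rename τ q)) = Ideal.Quotient.mk _ (ψ.toRingEquiv (rename τ q)) from
        Ideal.quotientEquiv_mk _ _ _ _ _]
      exact congrArg _ (hψ q)
    rw [RingEquiv.trans_apply, h1]
    change (MvPolynomial.quotientEquivQuotientMvPolynomial (Ideal.span {p})).symm _ = _
    rw [AlgEquiv.symm_apply_eq]
    have ha : (C (Ideal.Quotient.mk (Ideal.span {p}) q) : MvPolynomial ((Set.range τ)ᶜ : Set σ') (MvPolynomial σ R ⧸ Ideal.span {p})) =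
        algebraMap (MvPolynomial σ R) _ q := by
      rw [IsScalarTower.algebraMap_apply (MvPolynomial σ R) (MvPolynomial σ R ⧸ Ideal.span {p})
        (MvPolynomial ((Set.range τ)ᶜ : Set σ') (MvPolynomial σ R ⧸ Ideal.span {p})), Ideal.Quotient.algebraMap_eq, MvPolynomial.algebraMap_eq]
    rw [ha, AlgEquiv.commutes]
    rfl

/-- **Adjoining idle variables preserves regularity of hypersurface rings**: `R[σ]/(p)` regular ⇒ `R[σ']/(rename τ p)` regular (finitely many
idle variables). [folklore] -/
theorem isRegularRing_quotient_rename {R : Type u} [CommRing R] {σ σ' : Type u} [Finite σ'] (τ : σ → σ') (hτ : Function.Injective τ)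
    (p : MvPolynomial σ R) (h : IsRegularRing (MvPolynomial σ R ⧸ Ideal.span {p})) :
    IsRegularRing (MvPolynomial σ' R ⧸ Ideal.span {rename τ p}) := by
  obtain ⟨θ, -⟩ := exists_quotient_rename_equiv (R := R) τ hτ p
  haveI := h
  haveI : Finite ((Set.range τ)ᶜ : Set σ') := inferInstance
  exact IsRegularRing.of_ringEquiv (R := MvPolynomial ((Set.range τ)ᶜ : Set σ') (MvPolynomial σ R ⧸ Ideal.span {p})) θ.symm

/-! ## Affine blow-up algebras under polynomial base change -/

/-- **`A[I/a]` regular ⇒ `A[y][I·A[y]/a]` regular** (finitely many variables `y`): the square `A → A[y]`, `A[I/a] → A[y][I·A[y]/a]` is a pushout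
(blow-up algebras commute with flat base change, Stacks 0805, tree `BlowupAlgebraFlatBaseChange`), so `A[y][I·A[y]/a] ≅ A[y] ⊗_A A[I/a] ≅ (A[I/a])[y]`,
a polynomial ring over a regular ring. [cite: StacksProject, Tag 0805] -/
theorem isRegularRing_blowupAlgebra_mvPolynomial {A : Type u} [CommRing A] (I : Ideal A) (a : A) {ι : Type u} [Finite ι]
    (h : IsRegularRing (blowupAlgebra I a)) :
    IsRegularRing (blowupAlgebra (I.map (algebraMap A (MvPolynomial ι A))) (algebraMap A (MvPolynomial ι A) a)) := by
  set B := MvPolynomial ι A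
  set J : Ideal B := I.map (algebraMap A B)
  letI := (blowupAlgebraMap (algebraMap A B) I J a le_rfl).toAlgebra
  haveI : IsScalarTower A (blowupAlgebra I a) (blowupAlgebra J (algebraMap A B a)) :=
    IsScalarTower.of_algebraMap_eq fun x => by
      rw [RingHom.algebraMap_toAlgebra, blowupAlgebraMap_algebraMap, ← IsScalarTower.algebraMap_apply]
  -- the square `A → B`, `A[I/a] → B[J/a]` is a pushout (`B[J/a] = B ⊗_A A[I/a]`)
  haveI : Algebra.IsPushout A B (blowupAlgebra I a) (blowupAlgebra J (algebraMap A B a)) := by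
    obtain ⟨e, he⟩ := BlowupAlgebraFlatBaseChange.exists_baseChange_linearEquiv I J a le_rfl le_rfl
    refine ⟨IsBaseChange.of_equiv e fun r => ?_⟩
    rw [he, one_smul]
    rfl
  let e₁ : B ⊗[A] blowupAlgebra I a ≃ₐ[B] blowupAlgebra J (algebraMap A B a) :=
    Algebra.IsPushout.equiv A B (blowupAlgebra I a) (blowupAlgebra J (algebraMap A B a))
  let e₂ : blowupAlgebra I a ⊗[A] B ≃ₐ[blowupAlgebra I a] MvPolynomial ι (blowupAlgebra I a) := MvPolynomial.scalarRTensorAlgEquiv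
  let e₃ : B ⊗[A] blowupAlgebra I a ≃ₐ[A] blowupAlgebra I a ⊗[A] B := Algebra.TensorProduct.comm A B (blowupAlgebra I a)
  haveI := h
  haveI : IsRegularRing (MvPolynomial ι (blowupAlgebra I a)) := inferInstance
  exact IsRegularRing.of_ringEquiv (R := MvPolynomial ι (blowupAlgebra I a))
    ((e₂.toRingEquiv.symm.trans e₃.toRingEquiv.symm).trans e₁.toRingEquiv)

end IdleVar

end Summit.ResolutionOfSingularities.ResolutionOfSingularities.Cruxes.EquisingularLiftNat.Sections

end
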